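import Literature.NumberTheory.LFunctions.Zhang2022.RepairDetShift
import Literature.NumberTheory.LFunctions.Zhang2022.DetectorDoublingCompose

/-!
# Zhang (2022) §18-margin repair rung, barrier extension (cell landau-siegel §E, row S-E-p6-6):
# ROW 17 FLIPPED — the shift-detector family with the E-010 slot REMOVED from the verdict

Y. Zhang, *Discrete mean estimates and the Landau–Siegel zero*, arXiv:2211.02515v1 (2022) [Zhang2022LandauSiegel] —
an unrefereed manuscript under adjudication. **WHAT THIS IS NOT: a claim about its Theorems 1–2, about Landau–Siegel
zeros, about Parity, or about a repaired `Margin232`. The programme SEARCHES and TYPES; no claim about Landau–Siegel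
zeros, Theorems 1–2 of arXiv:2211.02515 or a repaired Margin232 until a kernel theorem says so.**

## What this leaf does (bookkeeping over landed calculus; no numerics, no new `Prop` facts)

Row 17 of the class of record is `Repair.familyDetShift` (`RepairDetShift`, p460173): designs `(b; u,u′; f,f′)` = a
SIGN-ADMISSIBLE three-shift detector `𝔠*_b = −iΠ_jM(ρ+ib_jα)/M′(ρ)` (`Det.SignAdmissible b`, the Lemma-2.3 shape, in the
Part-III box `Det.InShiftBox b`) run against one-sided kinked legs `u`, `f` on `[0,1]` with `u(1) = f(1) = 0` (range (7.2)
of Prop. 7.1); its verdict DISPLAYS the E-010 slot `Det.FormDetPSD (Det.shiftRecipe b)` («IF the detector's formula-I form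
is PSD on the one-sided class THEN `¬ (𝔅_b(u)·𝔅_b(f) < ‖P_b(u,f)‖²)`»).

The slot is registry row E-102 HEAD 2, `Det.MonomialConePSD (Set.Ioo 0 5)` (`DetectorEntangledCone`, p476440):
`∀ b, SignAdmissible b → (∀ j, b j ∈ (0,5)) → FormDetPSD (shiftRecipe b)`. This leaf records the flip:

* Part 1 (interface form, GIVEN head 2): `Repair.detShift_not_closing_of_monomialConePSD` — under `MonomialConePSD (0,5)`
  every member of row 17 satisfies the verdict's CONCLUSION outright; the slot-free family
  **`Repair.familyDetShiftUncond`** (same designs, same class predicate — `familyDetShiftUncond_sameClass` — verdict =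
  the bare conclusion `¬ (𝔅_b(u)·𝔅_b(f) < ‖P_b(u,f)‖²)`), decided GIVEN head 2
  (`familyDetShiftUncond_decided_of_monomialConePSD`, `rplus_detShiftUncond_decided_of_monomialConePSD`); the slot-free
  verdict implies row 17's (`familyDetShift_verdict_of_uncond`).
* Part 2 (E-102 head 2 IS a tree theorem by the DOUBLING route [K1]–[K6]: `Det.monomialConePSD_unit` /
  `Det.formDetPSD_shiftRecipe_of_signAdmissible`, `DetectorDoublingCompose` Part 3, ls-Bdet-typer-2 g2 p490608, on
  K1 ls-barrier-p2 g3 · K2 ls-barrier-p5 g3 · K3 ls-Bmulti-typer-2 g3 · K4/K5 in tree): the HYPOTHESIS-FREE versions —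
  **`Repair.detShift_not_closing : ∀ d : DetShiftDesign, d.InClass → d.VerdictFree`** (row 17's conclusion OUTRIGHT,
  class-wide), `familyDetShiftUncond_decided`, `rplus_detShiftUncond_decided`, the slot on the class
  (`DetShiftDesign.InClass.slot`), and the design-leg corollaries for every admissible detector.

Currency (C3(e)): `Det.FormDet (shiftRecipe b)` = the continued formula-I calculus of the candidate recipe on ONE-SIDED
kinked profiles (registry E-010 first half; E-det-main open off `b = (1,2,3)`, not claimed); the GLUED two-sided design
level is row S-E-p6-3, not this family. Nothing here is a statement about zeros. Standard axioms.

References: Y. Zhang, arXiv:2211.02515v1 (2022), §2 (2.13), Lemma 2.3 and its proof, (2.16)–(2.18), Props. 2.4–2.6,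
(2.32)–(2.33) [pp. 5–6, 10–11]; §7 Prop. 7.1, (7.2) [p. 44]; §10 (10.1). [cite: Zhang2022LandauSiegel, §§2, 7, 10]
-/

noncomputable section

open Real Complex ComplexConjugate

namespace Literature.NumberTheory.LFunctions.Zhang2022

namespace Repair

open Det

/-! ### Part 1 — the flip in interface form, GIVEN E-102 head 2 `Det.MonomialConePSD (Set.Ioo 0 5)` -/

namespace DetShiftDesign

/-- **The slot-free verdict of a shift-detector design**: the bare conclusion «no closing at main order for the
detector's own form and polar form», `¬ (𝔅_b(u)·𝔅_b(f) < ‖P_b(u,f)‖²)` — row 17's verdict with the E-010 slot removed.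
[cite: Zhang2022LandauSiegel, §2 (2.18), Props. 2.4–2.6, (2.32)–(2.33)] -/
def VerdictFree (d : DetShiftDesign) : Prop :=
  ¬ (FormDet (shiftRecipe d.b) d.u d.u' * FormDet (shiftRecipe d.b) d.f d.f'
      < ‖FormDetPolar (shiftRecipe d.b) d.u d.u' d.f d.f'‖ ^ 2)

/-- Row 17's verdict IS «slot → slot-free verdict» (definitional bookkeeping).
[cite: Zhang2022LandauSiegel, §2 (2.32)–(2.33)] -/
theorem verdict_iff_slot_imp_free (d : DetShiftDesign) :
    d.Verdict ↔ (FormDetPSD (shiftRecipe d.b) → d.VerdictFree) :=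
  Iff.rfl

/-- The slot-free verdict implies row 17's displayed-slot verdict. [cite: Zhang2022LandauSiegel, §2 (2.32)–(2.33)] -/
theorem verdict_of_verdictFree (d : DetShiftDesign) (h : d.VerdictFree) : d.Verdict := fun _ => h

/-- A member's detector lies in the E-102 box `(0,5)` channel by channel (`Det.InShiftBox` read as set membership).
[cite: Zhang2022LandauSiegel, §2 (2.13); §14 (14.2)] -/
theorem InClass.mem_box {d : DetShiftDesign} (h : d.InClass) : ∀ j, d.b j ∈ Set.Ioo (0:ℝ) 5 :=
  fun j => h.2.1 j

/-- Under E-102 head 2 the slot of every member holds. [cite: Zhang2022LandauSiegel, §7 Prop. 7.1 p.44, (7.2)] -/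
theorem InClass.slot_of_monomialConePSD {d : DetShiftDesign} (hE : MonomialConePSD (Set.Ioo 0 5))
    (h : d.InClass) : FormDetPSD (shiftRecipe d.b) :=
  hE d.b h.1 h.mem_box

end DetShiftDesign

/-- **ROW 17 FLIPPED, interface form.** GIVEN E-102 head 2 (`Det.MonomialConePSD (Set.Ioo 0 5)`), every design of the
shift-detector family — any sign-admissible `b` in the box, any one-sided kinked legs — satisfies
`¬ (𝔅_b(u)·𝔅_b(f) < ‖P_b(u,f)‖²)` OUTRIGHT (`not_repairable_detShift` with the slot fed from head 2).
[cite: Zhang2022LandauSiegel, §2 (2.18), Props. 2.4–2.6, (2.32)–(2.33); §7 Prop. 7.1 p.44] -/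
theorem detShift_not_closing_of_monomialConePSD (hE : MonomialConePSD (Set.Ioo 0 5)) :
    ∀ d : DetShiftDesign, d.InClass → d.VerdictFree :=
  fun d h => not_repairable_detShift d h (h.slot_of_monomialConePSD hE)

/-- the Cauchy–Schwarz inequality itself on the class, GIVEN head 2: `‖P_b(u,f)‖² ≤ 𝔅_b(u)·𝔅_b(f)`.
[cite: Zhang2022LandauSiegel, §2 after (2.33)] -/
theorem normSq_le_detShift_of_monomialConePSD (hE : MonomialConePSD (Set.Ioo 0 5)) (d : DetShiftDesign)
    (h : d.InClass) :
    ‖FormDetPolar (shiftRecipe d.b) d.u d.u' d.f d.f'‖ ^ 2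
      ≤ FormDet (shiftRecipe d.b) d.u d.u' * FormDet (shiftRecipe d.b) d.f d.f' :=
  normSq_le_detShift d h (h.slot_of_monomialConePSD hE)

/-- the threshold shape of the §2 final step on the class, GIVEN head 2: bounds `𝔅_b(u) ≤ q`, `𝔅_b(f) ≤ c_J`,
`dd ≤ ‖P_b(u,f)‖` never give `√(q·c_J) < dd`. [cite: Zhang2022LandauSiegel, §2 (2.18), Props. 2.4–2.6 p.6, (2.32)–(2.33)] -/
theorem not_sqrt_closing_detShift_of_monomialConePSD (hE : MonomialConePSD (Set.Ioo 0 5)) (d : DetShiftDesign)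
    (h : d.InClass) {q cJ dd : ℝ} (hq : FormDet (shiftRecipe d.b) d.u d.u' ≤ q)
    (hcJ : FormDet (shiftRecipe d.b) d.f d.f' ≤ cJ) (hd : dd ≤ ‖FormDetPolar (shiftRecipe d.b) d.u d.u' d.f d.f'‖) :
    ¬ (Real.sqrt (q * cJ) < dd) :=
  not_sqrt_closing_detShift d h (h.slot_of_monomialConePSD hE) hq hcJ hd

/-! ### The slot-free family (extension protocol of `RepairRplus`) -/

/-- **family «sign-admissible shift detector, one-sided legs, FormDet currency — SLOT-FREE verdict»**: the designs and
the class predicate of row 17 (`familyDetShift`) verbatim; the verdict is the bare conclusion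
`¬ (𝔅_b(u)·𝔅_b(f) < ‖P_b(u,f)‖²)` (nothing displayed, nothing conditional in the class).
[cite: Zhang2022LandauSiegel, §2 Lemma 2.3, (2.32)–(2.33)] -/
def familyDetShiftUncond : DesignFamily where
  Design := DetShiftDesign
  InClass := DetShiftDesign.InClass
  Verdict := DetShiftDesign.VerdictFree

/-- **Same designs, same class as row 17** — only the verdict changed (slot removed).
[cite: Zhang2022LandauSiegel, §2 Lemma 2.3, (2.32)–(2.33)] -/
theorem familyDetShiftUncond_sameClass :
    familyDetShiftUncond.Design = familyDetShift.Design ∧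
      ∀ d : DetShiftDesign, familyDetShiftUncond.InClass d ↔ familyDetShift.InClass d :=
  ⟨rfl, fun _ => Iff.rfl⟩

/-- The slot-free verdict unfolded. [cite: Zhang2022LandauSiegel, §2 (2.18), (2.32)–(2.33)] -/
theorem familyDetShiftUncond_verdict_iff (d : DetShiftDesign) :
    familyDetShiftUncond.Verdict d ↔
      ¬ (FormDet (shiftRecipe d.b) d.u d.u' * FormDet (shiftRecipe d.b) d.f d.f'
          < ‖FormDetPolar (shiftRecipe d.b) d.u d.u' d.f d.f'‖ ^ 2) :=
  Iff.rfl

/-- The slot-free family's verdict implies row 17's verdict, member by member.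
[cite: Zhang2022LandauSiegel, §2 (2.32)–(2.33)] -/
theorem familyDetShift_verdict_of_uncond (d : DetShiftDesign) (h : familyDetShiftUncond.Verdict d) :
    familyDetShift.Verdict d :=
  fun _ => h

/-- Conversely row 17's verdict together with its slot gives the slot-free verdict.
[cite: Zhang2022LandauSiegel, §2 (2.32)–(2.33)] -/
theorem familyDetShiftUncond_verdict_of_slot (d : DetShiftDesign) (hV : familyDetShift.Verdict d)
    (hs : FormDetPSD (shiftRecipe d.b)) : familyDetShiftUncond.Verdict d :=
  hV hs

/-- **`familyDetShiftUncond` is decided GIVEN E-102 head 2.** [cite: Zhang2022LandauSiegel, §2 (2.32)–(2.33)] -/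
theorem familyDetShiftUncond_decided_of_monomialConePSD (hE : MonomialConePSD (Set.Ioo 0 5)) :
    familyDetShiftUncond.Decided :=
  detShift_not_closing_of_monomialConePSD hE

/-- **`R⁺ ++ [familyDetShiftUncond]` is decided GIVEN E-102 head 2** (`RepairRplus.rplus_extend`).
[cite: Zhang2022LandauSiegel, §2 (2.32)–(2.33)] -/
theorem rplus_detShiftUncond_decided_of_monomialConePSD (hE : MonomialConePSD (Set.Ioo 0 5)) :
    ClassDecided (Rplus ++ [familyDetShiftUncond]) :=
  rplus_extend (familyDetShiftUncond_decided_of_monomialConePSD hE)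

/-! ### C4 under head 2: the genuine design legs of every calculus-class `θ`, every admissible detector, slot-free -/

section Legs

variable {θ : Theta} {b : Fin 3 → ℝ}

/-- **`𝔡`-block legs, any admissible detector, GIVEN head 2**: `¬ (𝔅_b(g₁)·𝔅_b(f) < ‖P_b(g₁,f)‖²)` for the
`(H₁, J₁)` legs `(h1Profile θ, tentT θ)` of every calculus-class `θ`. [cite: Zhang2022LandauSiegel, §10 (10.1), (10.12)–(10.13); §2 (2.32)–(2.33)] -/
theorem dLeg_not_closing_of_monomialConePSD (hE : MonomialConePSD (Set.Ioo 0 5))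
    (hb : SignAdmissible b ∧ InShiftBox b) (hθ : AdmissibleThetaCalc θ) : (dLeg b θ).VerdictFree :=
  detShift_not_closing_of_monomialConePSD hE _ (inClass_dLeg hb hθ)

/-- **`𝔡′`-block legs, any admissible detector, GIVEN head 2**: the same for the `(J₂, H₂)` legs
`(tentT θ.reflectJ, h2Profile θ)`. [cite: Zhang2022LandauSiegel, §10 (10.1), (10.14)–(10.16); §2 (2.32)–(2.33)] -/
theorem dPrimeLeg_not_closing_of_monomialConePSD (hE : MonomialConePSD (Set.Ioo 0 5))
    (hb : SignAdmissible b ∧ InShiftBox b) (hθ : AdmissibleThetaCalc θ) : (dPrimeLeg b θ).VerdictFree :=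
  detShift_not_closing_of_monomialConePSD hE _ (inClass_dPrimeLeg hb hθ)

end Legs

/-! ### Part 2 — HYPOTHESIS-FREE: E-102 head 2 is the tree theorem `Det.monomialConePSD_unit` (DOUBLING route) -/

/-- **The E-010 slot holds on the whole class**: every member's detector form is PSD on one-sided kinked profiles
(`Det.formDetPSD_shiftRecipe_of_signAdmissible`, K1–K6). [cite: Zhang2022LandauSiegel, §7 Prop. 7.1 p.44 with (7.2), (8.11)–(8.23)] -/
theorem DetShiftDesign.InClass.slot {d : DetShiftDesign} (h : d.InClass) : FormDetPSD (shiftRecipe d.b) :=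
  formDetPSD_shiftRecipe_of_signAdmissible h.1

/-- **ROW 17 FLIPPED — UNCONDITIONAL, CLASS-WIDE.** For EVERY design of the shift-detector family — any
sign-admissible `b` in the Part-III box, any one-sided kinked legs `u`, `f` — `¬ (𝔅_b(u)·𝔅_b(f) < ‖P_b(u,f)‖²)`
OUTRIGHT: the displayed slot of `Repair.familyDetShift` is discharged by the doubling route (E-102 head 2
`Det.monomialConePSD_unit`). A statement about the method's main terms; nothing about zeros.
[cite: Zhang2022LandauSiegel, §2 (2.18), Props. 2.4–2.6, (2.32)–(2.33); §7 Prop. 7.1 p.44] -/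
theorem detShift_not_closing : ∀ d : DetShiftDesign, d.InClass → d.VerdictFree :=
  detShift_not_closing_of_monomialConePSD monomialConePSD_unit

/-- Row 17's verdict AND its slot, member by member (the row reads «UNCONDITIONAL class-wide»).
[cite: Zhang2022LandauSiegel, §2 (2.32)–(2.33); §7 Prop. 7.1 p.44] -/
theorem familyDetShift_verdict_and_slot (d : DetShiftDesign) (h : d.InClass) :
    familyDetShift.Verdict d ∧ FormDetPSD (shiftRecipe d.b) :=
  ⟨familyDetShift_decided d h, h.slot⟩

/-- the Cauchy–Schwarz inequality itself on the class, unconditionally: `‖P_b(u,f)‖² ≤ 𝔅_b(u)·𝔅_b(f)`.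
[cite: Zhang2022LandauSiegel, §2 after (2.33)] -/
theorem normSq_le_detShift_unconditional (d : DetShiftDesign) (h : d.InClass) :
    ‖FormDetPolar (shiftRecipe d.b) d.u d.u' d.f d.f'‖ ^ 2
      ≤ FormDet (shiftRecipe d.b) d.u d.u' * FormDet (shiftRecipe d.b) d.f d.f' :=
  normSq_le_detShift d h h.slot

/-- the threshold shape of the §2 final step on the class, unconditionally: bounds `𝔅_b(u) ≤ q`, `𝔅_b(f) ≤ c_J`,
`dd ≤ ‖P_b(u,f)‖` never give `√(q·c_J) < dd`. [cite: Zhang2022LandauSiegel, §2 (2.18), Props. 2.4–2.6 p.6, (2.32)–(2.33)] -/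
theorem not_sqrt_closing_detShift_unconditional (d : DetShiftDesign) (h : d.InClass) {q cJ dd : ℝ}
    (hq : FormDet (shiftRecipe d.b) d.u d.u' ≤ q) (hcJ : FormDet (shiftRecipe d.b) d.f d.f' ≤ cJ)
    (hd : dd ≤ ‖FormDetPolar (shiftRecipe d.b) d.u d.u' d.f d.f'‖) : ¬ (Real.sqrt (q * cJ) < dd) :=
  not_sqrt_closing_detShift d h h.slot hq hcJ hd

/-- **`familyDetShiftUncond` is decided** — the slot-free row of record for row 17's designs.
[cite: Zhang2022LandauSiegel, §2 (2.32)–(2.33)] -/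
theorem familyDetShiftUncond_decided : familyDetShiftUncond.Decided := detShift_not_closing

/-- **`R⁺ ++ [familyDetShiftUncond]` is decided** (`RepairRplus.rplus_extend`). [cite: Zhang2022LandauSiegel, §2 (2.32)–(2.33)] -/
theorem rplus_detShiftUncond_decided : ClassDecided (Rplus ++ [familyDetShiftUncond]) :=
  rplus_extend familyDetShiftUncond_decided

/-- Both spellings of row 17 at once: `R⁺ ++ [familyDetShift, familyDetShiftUncond]` is decided.
[cite: Zhang2022LandauSiegel, §2 (2.32)–(2.33)] -/
theorem rplus_detShift_both_decided : ClassDecided (Rplus ++ [familyDetShift, familyDetShiftUncond]) :=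
  classDecided_append.2 ⟨rplus_decided,
    classDecided_cons familyDetShift_decided (classDecided_cons familyDetShiftUncond_decided classDecided_nil)⟩

section LegsUnconditional

variable {θ : Theta} {b : Fin 3 → ℝ}

/-- **`𝔡`-block legs, any admissible detector, unconditionally**: `¬ (𝔅_b(g₁)·𝔅_b(f) < ‖P_b(g₁,f)‖²)` for the
`(H₁, J₁)` legs of every calculus-class `θ`. [cite: Zhang2022LandauSiegel, §10 (10.1), (10.12)–(10.13); §2 (2.32)–(2.33)] -/
theorem dLeg_not_closing (hb : SignAdmissible b ∧ InShiftBox b) (hθ : AdmissibleThetaCalc θ) :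
    (dLeg b θ).VerdictFree :=
  detShift_not_closing _ (inClass_dLeg hb hθ)

/-- **`𝔡′`-block legs, any admissible detector, unconditionally.**
[cite: Zhang2022LandauSiegel, §10 (10.1), (10.14)–(10.16); §2 (2.32)–(2.33)] -/
theorem dPrimeLeg_not_closing (hb : SignAdmissible b ∧ InShiftBox b) (hθ : AdmissibleThetaCalc θ) :
    (dPrimeLeg b θ).VerdictFree :=
  detShift_not_closing _ (inClass_dPrimeLeg hb hθ)

/-- The named members at `θ₀` for the two off-print boxes `bOffLattice`, `bNearLattice` now carry the CONCLUSION (no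
displayed slot, no numerics). [cite: Zhang2022LandauSiegel, §2 (2.13), (2.21)–(2.28)] -/
theorem legs_theta0_not_closing :
    (dLeg bOffLattice theta0).VerdictFree ∧ (dPrimeLeg bOffLattice theta0).VerdictFree ∧
      (dLeg bNearLattice theta0).VerdictFree ∧ (dPrimeLeg bNearLattice theta0).VerdictFree :=
  ⟨dLeg_not_closing signAdmissible_bOffLattice admissible_theta0.toCalc,
    dPrimeLeg_not_closing signAdmissible_bOffLattice admissible_theta0.toCalc,
    dLeg_not_closing signAdmissible_bNearLattice admissible_theta0.toCalc,
    dPrimeLeg_not_closing signAdmissible_bNearLattice admissible_theta0.toCalc⟩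

end LegsUnconditional

end Repair

end Literature.NumberTheory.LFunctions.Zhang2022
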